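import Summits.NavierStokesRegularity.FluidComputer.PalasekTowerHeredityWitnessWindow

/-!
# REGISTER v2.3′: the heredity witness — the WINDOW form of the rungs and of the base

Cell `ns-blowup`, seat `ns-blowup-ecbridge-6` (g3; D-0074 GROUP C «BRIDGE SUPPORT»; bears_on LADDER-NS N1,
route `PalasekTowerBreakdown`, base crux item stmt-NavierStokesRegularity-19179 `EpisodeBase` =
`EpisodeBaseG` = `RungG 1`, and the rungs `RungG K` of `PalasekTowerRegisterGlobalTail.lean`; supports
only, nothing claimed). Sequel of `PalasekTowerHeredityWitnessWindow.lean` (p433214: ONE WINDOW RUN from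
a registered stage's own state extends the stage — `Stage.exists_extends_of_window_solution`, its
converse `Stage.Extends.window_solution`). LABEL: E–C typing (KERNEL plumbing; theorems only, no
definition, no named fact). WHAT THIS IS NOT: not Navier–Stokes evidence — no stage, host, flow, tower
or blow-up is constructed or asserted; `EpisodeBaseG` / `RungG K` stay OPEN and appear only inside
equivalences.

* `rungG_succ_iff_exists_window_solution K` — `RungG (K+1)` (some pinned rigid quiet wide design has a
  registered stage at level `K+1`) ⇔ some pinned rigid quiet wide design has a registered stage `s`
  at level `K` AND one window run: a classical solution of the design's system on `[τ K - ε, τ (K+1)]`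
  (some `0 < ε ≤ τ K`) from the stage's own state `s.u (τ K - ε)`, with finite energy there, below
  `c₂ Y_{K+1}` on `[τ K, τ (K+1)]`, meeting the three level-`K+1` floors at `τ (K+1)`;
* `episodeBaseG_iff_exists_window_solution_zero` — the base item by value: `EpisodeBaseG` ⇔ a
  PREPARED HOST (pinned rigid quiet wide design with a registered level-`0` stage — ecbridge-3's
  `Host.rungG_zero` inhabits this class) whose state at some time `τ₀ - ε` launches ONE WINDOW RUN
  on `[τ₀ - ε, τ₁]` under the design force (active until `τ₁`), finite energy, below `(5/3) Y₁` on
  `[τ₀, τ₁]`, reaching at `τ₁`, in the ball, speed `≥ Y₁`, gradient `≥ A₁` and an `N₁`-core loop.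
  Compare p423427 `episodeBaseG_iff_exists_levelWitness_zero` (DATUM form: the host's flow re-run from
  `t = 0`); here nothing on `[0, τ₀ - ε]` is re-certified.

References: S. Palasek, arXiv:2605.13827 §4 [cite: Palasek2026ElementaryModel, §4]; H. Sohr, *The
Navier–Stokes Equations*, Birkhäuser 2001, Ch. V Thm. 1.5.1 [cite: Sohr2001, Ch. V Thm. 1.5.1].
-/

noncomputable section

namespace Summit.NavierStokesRegularity.FluidComputer.PalasekTowerClayBridge

open Set MeasureTheory Filter Topology Function Real
open scoped ENNReal ContDiff NNReal
open Literature.Analysis.FluidPDE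

/-- **The next rung ⇔ a registered stage plus ONE WINDOW RUN** (unit viscosity, wide rates, any
level `K`): `RungG (K+1)` iff some pinned (`Λ = 8`, `θ = 6/5`), rigid, quiet design has a globally
anchored registered stage `s` at level `K` and a classical solution of its system on
`[τ K - ε, τ (K+1)]`, some `0 < ε ≤ τ K`, from `s.u (τ K - ε)`, with finite energy, below
`c₂ Y_{K+1}` on `[τ K, τ (K+1)]`, with the three level-`K+1` floors at `τ (K+1)` (⇐ by
`Stage.exists_extends_of_window_solution`; ⇒ restrict the level-`K+1` stage and read it as its own
window run). [cite: Sohr2001, Ch. V Thm. 1.5.1] -/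
theorem rungG_succ_iff_exists_window_solution (K : ℕ) :
    RungG (K + 1) ↔ ∃ S : Schedule TowerRates.wide, S.Pins 8 (6 / 5) ∧ S.Rigid ∧ S.Quiet ∧
      ∃ s : Stage 1 TowerRates.wide S (Margins.routeG TowerRates.wide) K,
        ∃ ε : ℝ, 0 < ε ∧ ε ≤ S.τ K ∧
        ∃ (v : ℝ → EuclideanSpace ℝ (Fin 3) → EuclideanSpace ℝ (Fin 3))
          (q : ℝ → EuclideanSpace ℝ (Fin 3) → ℝ),
          IsClassicalNSSolutionOn (Icc (S.τ K - ε) (S.τ (K + 1))) 1 S.f v q ∧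
          v (S.τ K - ε) = s.u (S.τ K - ε) ∧
          (∃ C : ℝ≥0∞, C < ⊤ ∧ ∀ t ∈ Icc (S.τ K - ε) (S.τ (K + 1)), ∫⁻ x, ‖v t x‖ₑ ^ 2 ≤ C) ∧
          (∀ t ∈ Icc (S.τ K) (S.τ (K + 1)), ∀ x, ‖v t x‖ ≤ S.c₂ * TowerRates.wide.Y (K + 1)) ∧
          (∃ x, ‖x‖ ≤ S.radius ∧ S.c₁ * TowerRates.wide.Y (K + 1) ≤ ‖v (S.τ (K + 1)) x‖) ∧
          (∃ x, ‖x‖ ≤ S.radius ∧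
            S.c₁ * TowerRates.wide.A (K + 1) ≤ ‖fderiv ℝ (v (S.τ (K + 1))) x‖) ∧
          (∃ (x : EuclideanSpace ℝ (Fin 3)) (γ : ℝ → EuclideanSpace ℝ (Fin 3)),
            ‖x‖ ≤ S.radius ∧ ContDiff ℝ 1 γ ∧ γ 0 = γ 1 ∧
            (∀ σ ∈ Icc (0 : ℝ) 1, γ σ ∈ Metric.closedBall x (1 / TowerRates.wide.N (K + 1))) ∧
            (∀ σ ∈ Icc (0 : ℝ) 1, ‖deriv γ σ‖ ≤ 8 * π / TowerRates.wide.N (K + 1)) ∧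
            S.c₁ * TowerRates.wide.N (K + 1) ^ (TowerRates.wide.β - 2) ≤
              circulation (v (S.τ (K + 1))) γ) := by
  constructor
  · rintro ⟨S, hP, hR, hQ, ⟨s₁⟩⟩
    have hτ : 0 < S.τ K := S.τ_pos K
    set s : Stage 1 TowerRates.wide S (Margins.routeG TowerRates.wide) K :=
      s₁.restrictOfAntitone (Margins.antitone_routeG TowerRates.wide) (Nat.le_succ K) with hs
    have hss : s.Extends s₁ :=
      Stage.restrictOfAntitone_extends (Margins.antitone_routeG TowerRates.wide) s₁
    obtain ⟨h1, h2, h3, h4, h5, h6, h7⟩ := Stage.Extends.window_solution s s₁ hss hτ le_rfl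
    exact ⟨S, hP, hR, hQ, s, S.τ K, hτ, le_rfl, s₁.u, s₁.p, h1, h2, h3, h4, h5, h6, h7⟩
  · rintro ⟨S, hP, hR, hQ, s, ε, hε, hεK, v, q, hcl, h0, henergy, hceil, hfloor, hstrain, hcore⟩
    obtain ⟨s', -⟩ :=
      s.exists_extends_of_window_solution one_pos hε hεK hcl h0 henergy hceil hfloor hstrain hcore
    exact ⟨S, hP, hR, hQ, ⟨s'⟩⟩

/-- **The base item in WINDOW form — no hypothesis**: `EpisodeBaseG` (= `RungG 1`, item 19179) iff
some PREPARED HOST — a pinned (`Λ = 8`, `θ = 6/5`), rigid, quiet design on the wide-base rates with a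
globally anchored registered stage `s` at level `0` — launches from its own state `s.u (τ₀ - ε)`,
some `0 < ε ≤ τ₀`, ONE WINDOW RUN: a classical solution of the design's (forced) system on
`[τ₀ - ε, τ₁]` with finite energy, below `(5/3) Y₁` on `[τ₀, τ₁]`, showing at `τ₁`, in the ball,
speed `≥ Y₁`, gradient `≥ A₁` and a loop of length `≤ 8π/N₁` inside a ball of radius `1/N₁` with
circulation `≥ N₁^{3/10}` (numbers: `PalasekTowerHeredityWitnessCalibration.lean`, p432248).
[cite: Sohr2001, Ch. V Thm. 1.5.1] -/
theorem episodeBaseG_iff_exists_window_solution_zero :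
    EpisodeBaseG ↔ ∃ S : Schedule TowerRates.wide, S.Pins 8 (6 / 5) ∧ S.Rigid ∧ S.Quiet ∧
      ∃ s : Stage 1 TowerRates.wide S (Margins.routeG TowerRates.wide) 0,
        ∃ ε : ℝ, 0 < ε ∧ ε ≤ S.τ 0 ∧
        ∃ (v : ℝ → EuclideanSpace ℝ (Fin 3) → EuclideanSpace ℝ (Fin 3))
          (q : ℝ → EuclideanSpace ℝ (Fin 3) → ℝ),
          IsClassicalNSSolutionOn (Icc (S.τ 0 - ε) (S.τ 1)) 1 S.f v q ∧
          v (S.τ 0 - ε) = s.u (S.τ 0 - ε) ∧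
          (∃ C : ℝ≥0∞, C < ⊤ ∧ ∀ t ∈ Icc (S.τ 0 - ε) (S.τ 1), ∫⁻ x, ‖v t x‖ₑ ^ 2 ≤ C) ∧
          (∀ t ∈ Icc (S.τ 0) (S.τ 1), ∀ x, ‖v t x‖ ≤ S.c₂ * TowerRates.wide.Y 1) ∧
          (∃ x, ‖x‖ ≤ S.radius ∧ S.c₁ * TowerRates.wide.Y 1 ≤ ‖v (S.τ 1) x‖) ∧
          (∃ x, ‖x‖ ≤ S.radius ∧ S.c₁ * TowerRates.wide.A 1 ≤ ‖fderiv ℝ (v (S.τ 1)) x‖) ∧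
          (∃ (x : EuclideanSpace ℝ (Fin 3)) (γ : ℝ → EuclideanSpace ℝ (Fin 3)),
            ‖x‖ ≤ S.radius ∧ ContDiff ℝ 1 γ ∧ γ 0 = γ 1 ∧
            (∀ σ ∈ Icc (0 : ℝ) 1, γ σ ∈ Metric.closedBall x (1 / TowerRates.wide.N 1)) ∧
            (∀ σ ∈ Icc (0 : ℝ) 1, ‖deriv γ σ‖ ≤ 8 * π / TowerRates.wide.N 1) ∧
            S.c₁ * TowerRates.wide.N 1 ^ (TowerRates.wide.β - 2) ≤ circulation (v (S.τ 1)) γ) :=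
  rungG_one_iff.symm.trans (rungG_succ_iff_exists_window_solution 0)

end Summit.NavierStokesRegularity.FluidComputer.PalasekTowerClayBridge

end
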